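import Summits.ABC.ABC.Theorems.TwistAmplificationMazurKaneLawRecordDictionary
import Summits.ABC.ABC.Theorems.TwistAmplificationMazurKaneLawRecordLPR35
import Summits.ABC.ABC.Theorems.TwistAmplificationMazurKaneLawRecordEndgame
import Summits.ABC.ABC.Theorems.TwistAmplificationMazurKaneLawRecordTransfer
import Summits.ABC.ABC.Theorems.TwistAmplificationMazurKaneLawSlices
import Literature.NumberTheory.DiophantineGeometry.AbcWave0

/-!
# Certified record exponents, pipeline v2 (crux `TwistAmplification.MazurKaneLaw`, stmt-ABC-2757): abc hits `≪ X^{3/5+ε}`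

Line `fibre-toolkit-lp-wall-map`, lead c2. The crux (`#{abc, c ≤ N, rad(abc) ≤ c^s} ≤ C N^{s−1+ε}`, `1 < s < 2`) stays open; this
file assembles the first record of the v2 pipeline — generated LP lemma in `J = 5` explicit levels (`lp_R35`, files
`…RecordLPR35P1.lean`, `…RecordLPR35.lean`) → J-generic dictionary theorem `recordInstance_of_lp` (`…RecordDictionary.lean`) → generic
endgame / transfer of lead c1:

* `recordAt_35 : RecordAt (1001/1000) (3/5)` — for every `s < 1001/1000` (in particular every `s ≤ 1`) and `ε > 0`,
  `#{abc triples, c ≤ N, rad(abc) ≤ c^s} ≤ C · N^{3/5 + ε}`;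
* `abcHitCount_le_rpow_three_fifths` — the number `N(X)` of abc HITS (`rad(abc) < c ≤ X`) is `≪_ε X^{3/5+ε}`, improving the
  tree's `31/50` (`abcHitCount_le_rpow_thirtyOne_fiftieths`, lead c1, `J = 4`) and the 2026 literature value `13/20` at `λ = 1`
  (Bernert–Browning–Lichtman–Teräväinen v2, Thm 1.2), and matching at `λ = 1` the exponent `3/5` that their Thm 1.3 gives only for
  `λ < 1`. The exact value of the kit's LP at `s = 1` is `0.5826…` (`J → ∞`; `0.5861` at `J = 5`, `0.5850` at `J = 6`), so `7/12` needs a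
  finer slack than `RecordInstance`'s `1/1000` and is left to a later file.
-/

noncomputable section

-- `Summit.<Summit>.<Problem>`: the duplicate `ABC.ABC` is deliberate (single-conjunct summit).
set_option linter.dupNamespace false

namespace Summit.ABC.ABC.Theorems.MazurKaneLaw

open Summit.ABC.ABC.Theorems.MazurKaneLaw.Toolkit

/-- **Record instance `R35`** (registered sub-goal `recordInstance_R35`): `RecordInstance 5 (1001/1000) (3/5)`, from the generated LP
lemma `lp_R35` through the J-generic dictionary theorem `recordInstance_of_lp`. -/
theorem recordInstance_R35 : Summit.ABC.ABC.Theorems.MazurKaneLaw.Toolkit.RecordInstance 5 (1001 / 1000) (3 / 5) :=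
  recordInstance_of_lp 5 (1001 / 1000) (3 / 5) (by norm_num) lp_R35

/-- **Certified record at `s₀ = 1001/1000` with exponent `3/5`** (registered sub-goal `recordAt_35` of crux stmt-ABC-2757): for every
`s < 1001/1000` and `ε > 0` there is `C` with `#{abc triples (a,b,c) : c ≤ N, rad(abc) ≤ c^s} ≤ C · N^{3/5 + ε}` for all `N ≥ 2`. -/
theorem recordAt_35 : Summit.ABC.ABC.Theorems.MazurKaneLaw.Toolkit.RecordAt (1001 / 1000) (3 / 5) :=
  recordAt_of_shapeBound 5 (1001 / 1000) (3 / 5) (by norm_num) (by norm_num) (by norm_num) (by norm_num)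
    (shapeCount_le_of_recordInstance 5 (1001 / 1000) (3 / 5) (by norm_num) (by norm_num) recordInstance_R35)

/-- The record in the crux's literal shape at every `s ≤ 1`: `#{abc triples, c ≤ N, rad(abc) ≤ c^s} ≤ C · N^{3/5+ε}`. -/
theorem mazurKane_count_le_rpow_three_fifths (s : ℝ) (hs : s ≤ 1) (ε : ℝ) (hε : 0 < ε) :
    ∃ C : ℝ, ∀ N : ℕ, 2 ≤ N →
      (Set.ncard {t : ℕ × ℕ × ℕ | Literature.NumberTheory.DiophantineGeometry.IsABCTriple t.1 t.2.1 t.2.2 ∧ t.2.2 ≤ N ∧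
        ((Literature.NumberTheory.DiophantineGeometry.rad t.1 t.2.1 t.2.2 : ℕ) : ℝ) ≤ (t.2.2 : ℝ) ^ s} : ℝ) ≤
        C * (N : ℝ) ^ ((3 / 5 : ℝ) + ε) :=
  recordAt_35 s (by linarith) ε hε

/-- **The abc-hit record: `N(X) ≪_ε X^{3/5 + ε}`** (registered sub-goal `abcHitCount_le_rpow_three_fifths`). The number of abc hits
`(a, b, c)` (`a + b = c` coprime, `rad(abc) < c`) with `c ≤ X` is at most `C(ε) · X^{3/5 + ε}` for `X ≥ 2` — compare `31/50` (this tree,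
lead c1), `13/20` (BBLT v2 Thm 1.2 at `λ = 1`, 2026) and `2/3` (trivial). From `recordAt_35` at `s = 1`: a hit has `rad(abc) < c = c^1`.
Proof pattern: `abcHitCount_le_rpow_thirtyOne_fiftieths`. -/
theorem abcHitCount_le_rpow_three_fifths : ∀ ε : ℝ, 0 < ε → ∃ C : ℝ, ∀ X : ℕ, 2 ≤ X → (Literature.NumberTheory.DiophantineGeometry.abcHitCount X : ℝ) ≤ C * (X : ℝ) ^ ((3 / 5 : ℝ) + ε) := by
  intro ε hε
  -- adapted from `abcHitCount_le_rpow_thirtyOne_fiftieths` (TwistAmplificationMazurKaneLawRecords.lean)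
  obtain ⟨C, hC⟩ := recordAt_35 1 (by norm_num) ε hε
  refine ⟨C, fun X hX => le_trans ?_ (hC X hX)⟩
  have hsub : {t : ℕ × ℕ × ℕ | Literature.NumberTheory.DiophantineGeometry.IsABCTriple t.1 t.2.1 t.2.2 ∧ t.2.2 ≤ X ∧
        Literature.NumberTheory.DiophantineGeometry.rad t.1 t.2.1 t.2.2 < t.2.2} ⊆
      {t : ℕ × ℕ × ℕ | Literature.NumberTheory.DiophantineGeometry.IsABCTriple t.1 t.2.1 t.2.2 ∧ t.2.2 ≤ X ∧
        ((Literature.NumberTheory.DiophantineGeometry.rad t.1 t.2.1 t.2.2 : ℕ) : ℝ) ≤ (t.2.2 : ℝ) ^ (1 : ℝ)} := by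
    rintro t ⟨ht, htX, hlt⟩
    refine ⟨ht, htX, ?_⟩
    rw [Real.rpow_one]
    exact_mod_cast hlt.le
  have hfin : {t : ℕ × ℕ × ℕ | Literature.NumberTheory.DiophantineGeometry.IsABCTriple t.1 t.2.1 t.2.2 ∧ t.2.2 ≤ X ∧
      ((Literature.NumberTheory.DiophantineGeometry.rad t.1 t.2.1 t.2.2 : ℕ) : ℝ) ≤ (t.2.2 : ℝ) ^ (1 : ℝ)}.Finite :=
    Summit.ABC.ABC.Theorems.MazurKaneLaw.finite_of_isABCTriple X fun _ ht => ⟨ht.1, ht.2.1⟩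
  rw [Literature.NumberTheory.DiophantineGeometry.abcHitCount]
  exact_mod_cast Set.ncard_le_ncard hsub hfin

end Summit.ABC.ABC.Theorems.MazurKaneLaw

end
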